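import Literature.NumberTheory.Rogawski1990.LocalNormFibreNonsplit        -- ★ p840359: the norm fibre `S` at `γ₀` (`exists_finset_normFibre…`), `IsLocalNormPair.charpoly_eq` …
import Literature.NumberTheory.Rogawski1990.EndoscopicCentralizerIso       -- ★ `mem_range_endoEmb_of_mem_centralizer`, `pattern_of_commute_diag`, `diag_commute_coe_endoEmb`, `isUnit_two_localRing`
import Literature.NumberTheory.Automorphic.StableCentralizerEquivCM        -- ★ `conj_mem_unitaryGroup_of_conj_eq`, `commute_of_commute_of_isRegularElt_local`, `isUnit_adelicForm_map_adeleToLocal`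
import HarnessLib

/-!
# The norm fibre is UNIFORM along a matched torus: a `G`-regular `γ_H` matching a point `t′` of the `G′`-torus `Z_{G′_v}(γ₀)` is stably conjugate to the
# transport of `t′` into the `H`-torus of one of the fibre representatives at `γ₀` (Rogawski 1990, §4.3 pp. 42–44, §5.4 p. 78)

Topic `NumberTheory/Rogawski1990`; namespace `Literature.NumberTheory.Rogawski1990`.  THEOREMS ONLY (no definition, no instance, no notation, no named fact,
no `sorry`; Mathlib-only footing; count-neutral for the books).  Cell `pub/hodgecm-mathlib` (D-0151), crux H413 = stmt-HodgeConjecture-24833, F0∕P3a road «D-N6-ns»,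
floor-1 target «N6-ns-reg»; brick **(W2′) «UNIFORM FIBRE ALONG THE TRANSPORTED TORUS»** of F0P2-p02 (g8)'s junction design v2 (bus 2026-09-01T02:59:39Z) for
`Rogawski1990/LocalTransferChartJunctionCM.lean`; sequel of ★ `LocalNormFibreNonsplit` ((F1)–(F3), p840359).  HONEST LABEL: HC_CM is proved only modulo the printed
citations until rung 0 closes; this file proves no letter — it is torus bookkeeping for the (4.3.1) junction.

THE MATHEMATICS.  Fix a regular `γ₀ ∈ G′_v = U(H′)(L⁺_v)` and the finite set `S ⊂ H_v = U(Φ₂)(L⁺_v) × U(Φ₁)(L⁺_v)` of `G`-regular fibre representatives at `γ₀`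
(every `G`-regular `a₀` matching `γ₀` is stably conjugate to some `t ∈ S`, ★ `exists_finset_normFibre`).  Let `t′ ∈ Z_{G′_v}(γ₀)` and `a ∈ H_v` `G`-regular with
`ι_v(a) ↔ t′`, say `y ι(a) y⁻¹ = t′`, `y ∈ GL₃(E_v)`.  Then `g := y⁻¹ γ₀ y` commutes with the regular `ι(a)`, so (the commutant being commutative and containing
`ι(1, −1) = diag(1, −1, 1)`) it has the block pattern of `ι` (★ `mem_range_endoEmb_of_mem_centralizer`), and it is `Φ₃`-unitary (★ `conj_mem_unitaryGroup_of_conj_eq`):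
`g = ι(a₀)` with `a₀ ∈ H_v` `G`-regular matching `γ₀` (§2).  Hence `a₀ ∼_st t` for some `t ∈ S`, i.e. `h ι(a₀) h⁻¹ = ι(t)` with `h` BLOCK-DIAGONAL.  For any conjugator `x`
with `x ι(t) x⁻¹ = γ₀`, the element `k := h⁻¹ x⁻¹ y` commutes with `ι(a₀)`, hence is block-diagonal (§1), and for the torus transport `b` of `t′` into `Z_H(t)` — the
element with `x ι(b) x⁻¹ = t′` — we get `ι(a) = y⁻¹ t′ y = (h k)⁻¹ ι(b) (h k)` with `h k` block-diagonal: `a ∼_st b` (§3).  So the fibre representatives chosen AT `γ₀`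
serve along the whole torus, which is what lets the junction index its `H`-boxes by `S` once and for all.  Every finite place `v` (split or not); only `det H′ ≠ 0`.

* §1 `mem_range_endoGL_of_commute` (the `GL₃`-centraliser of `ι(a₀)`, `a₀` `G`-regular, is block-diagonal), `isLocalStablyConjH_of_endoGL_conj_eq`
  (conjugation by a block-diagonal element of `GL₃(E_v)` is stable conjugacy in `H_v`).
* §2 `exists_preimage_of_conj_eq_of_commute` (`y⁻¹ γ₀ y = ι(a₀)` with `a₀` `G`-regular, matching `γ₀`).
* §3 `exists_endoGL_eq_inv_mul` (the conjugator `y⁻¹ x` is block-diagonal), **`exists_mem_forall_isLocalStablyConjH_of_conj_eq`** ((W2′), primitive conjugator binders).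

## References
* [Rogawski1990] J. D. Rogawski, *Automorphic Representations of Unitary Groups in Three Variables*, Ann. of Math. Stud. 123 (1990): §3.1 p. 19, §4.3 pp. 42–44
  (`T_H = H_{γ_H}` and `T = G_γ` identified for `G`-regular `γ_H`), §4.8 Case (a) p. 53 (the embedding `ι`), §5.4 p. 78 (the stable classes of `H` over a class of `G`).
* [LanglandsShelstad1987] R. P. Langlands, D. Shelstad, *On the definition of transfer factors*, Math. Ann. 278 (1987), §1.3.
-/

set_option autoImplicit false

noncomputable section

open NumberField IsDedekindDomain Matrix
open scoped MatrixGroups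

namespace Literature.NumberTheory.Rogawski1990

open Literature.AlgebraicGeometry.ShimuraVarieties (unitaryGroup)
open Literature.NumberTheory.Automorphic Literature.NumberTheory.Automorphic.UnitaryGroup

variable (L : Type) [Field L] [NumberField L] [IsCMField L] (H' : Matrix (Fin 3) (Fin 3) L) (v : HeightOneSpectrum (𝓞 ↥(maximalRealSubfield L)))

/-! ## §1 Block-diagonal elements of `GL₃(E_v)`: the centraliser of `ι(a₀)` and stable conjugacy in `H_v` -/

section Blocks

variable {a b a₀ : (cmDatum L 2 (Matrix.of fun i j : Fin 2 => if i.val + j.val + 1 = 2 then (1 : L) else 0)).Local v ×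
      (cmDatum L 1 (Matrix.of fun i j : Fin 1 => if i.val + j.val + 1 = 1 then (1 : L) else 0)).Local v}

/-- **The `GL₃(E_v)`-centraliser of `ι_v(a₀)` is block-diagonal** for `G`-regular `a₀`: an invertible `k` commuting with `ι_v(a₀)` lies in `ι(GL₂ × GL₁)` (the
commutant of the regular `ι_v(a₀)` is commutative and contains `ι(1, −1) = diag(1, −1, 1)`, ★ `diag_commute_coe_endoEmb`; commuting with it forces the pattern
`(* 0 *; 0 * 0; * 0 *)`, ★ `pattern_of_commute_diag`, ★ `mem_range_endoGL_iff`). [cite: Rogawski1990, §4.3 p. 42; §4.8 Case (a) p. 53] -/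
theorem mem_range_endoGL_of_commute (ha₀ : IsLocalGRegular L v a₀) {k : GL (Fin 3) (LocalRing L v)}
    (hk : k * ((endoEmbLocal L v a₀).val : GL (Fin 3) (LocalRing L v)) = ((endoEmbLocal L v a₀).val : GL (Fin 3) (LocalRing L v)) * k) :
    k ∈ Set.range (endoGL : GL (Fin 2) (LocalRing L v) × GL (Fin 1) (LocalRing L v) → GL (Fin 3) (LocalRing L v)) := by
  rw [mem_range_endoGL_iff]
  have hcomm := commute_of_commute_of_isRegularElt_local L v (endoEmbLocal L v a₀) ha₀
  have hkC : Commute k.val ((endoEmbLocal L v a₀).val : GL (Fin 3) (LocalRing L v)).val := by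
    change k.val * _ = _ * k.val
    rw [← Units.val_mul, hk, Units.val_mul]
  exact pattern_of_commute_diag (isUnit_two_localRing L v)
    (hcomm _ _ hkC (diag_commute_coe_endoEmb (UnitaryGroup.conjLocal L (IsCMField.complexConj L) v) (endoForm_localForm L v) a₀))

/-- **Conjugation by a block-diagonal element of `GL₃(E_v)` is stable conjugacy in `H_v`**: if `ι(p) ι_v(b) ι(p)⁻¹ = ι_v(a)` for some
`p ∈ GL₂(E_v) × GL₁(E_v)` then `a ∼_st b` (componentwise conjugacy in the ambient `GL₂ × GL₁`, ★ `endoGL_injective`). [cite: Rogawski1990, §3.1 p. 19; §4.8 Case (a) p. 53] -/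
theorem isLocalStablyConjH_of_endoGL_conj_eq {p : GL (Fin 2) (LocalRing L v) × GL (Fin 1) (LocalRing L v)}
    (h : endoGL p * ((endoEmbLocal L v b).val : GL (Fin 3) (LocalRing L v)) * (endoGL p)⁻¹ = (endoEmbLocal L v a).val) :
    IsLocalStablyConjH L v a b := by
  have e : ∀ c : (cmDatum L 2 (Matrix.of fun i j : Fin 2 => if i.val + j.val + 1 = 2 then (1 : L) else 0)).Local v ×
      (cmDatum L 1 (Matrix.of fun i j : Fin 1 => if i.val + j.val + 1 = 1 then (1 : L) else 0)).Local v,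
      ((endoEmbLocal L v c).val : GL (Fin 3) (LocalRing L v)) =
        endoGL ((c.1.val : GL (Fin 2) (LocalRing L v)), (c.2.val : GL (Fin 1) (LocalRing L v))) := fun _ => rfl
  rw [e, e, ← map_inv, ← map_mul, ← map_mul] at h
  have h' := endoGL_injective h
  rw [Prod.ext_iff] at h'
  obtain ⟨h1, h2⟩ := h'
  simp only [Prod.fst_mul, Prod.snd_mul, Prod.fst_inv, Prod.snd_inv] at h1 h2
  refine ⟨isConj_iff.2 ⟨p.1⁻¹, ?_⟩, isConj_iff.2 ⟨p.2⁻¹, ?_⟩⟩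
  · rw [← h1]; group
  · rw [← h2]; group

end Blocks

/-! ## §2 Pulling a regular element of the `G′`-torus back through a matching -/

section Preimage

variable {a : (cmDatum L 2 (Matrix.of fun i j : Fin 2 => if i.val + j.val + 1 = 2 then (1 : L) else 0)).Local v ×
      (cmDatum L 1 (Matrix.of fun i j : Fin 1 => if i.val + j.val + 1 = 1 then (1 : L) else 0)).Local v}
  {t' : (cmDatum L 3 H').Local v}

/-- **`y⁻¹ γ₀ y = ι_v(a₀)`**: if `y ι_v(a) y⁻¹ = t′ ∈ G′_v` with `a` `G`-regular, and `γ₀ ∈ G′_v` is regular and commutes with `t′`, then `y⁻¹ γ₀ y` is `ι_v` of a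
`G`-regular `a₀ ∈ H_v` matching `γ₀` (unitarity for `Φ₃`: ★ `conj_mem_unitaryGroup_of_conj_eq`; block pattern: ★ `mem_range_endoEmb_of_mem_centralizer`).
[cite: Rogawski1990, §4.3 pp. 42–44; §3.1 p. 19] [cite: LanglandsShelstad1987, §1.3] -/
theorem exists_preimage_of_conj_eq_of_commute (hH' : H'.det ≠ 0) (ha : IsLocalGRegular L v a) {y : GL (Fin 3) (LocalRing L v)}
    (hy : y * ((endoEmbLocal L v a).val : GL (Fin 3) (LocalRing L v)) * y⁻¹ = t'.val) (γ₀ : (cmDatum L 3 H').Local v)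
    (hγ₀ : IsRegularElt (γ₀.val : GL (Fin 3) (LocalRing L v))) (hc : t' * γ₀ = γ₀ * t') :
    ∃ a₀ : (cmDatum L 2 (Matrix.of fun i j : Fin 2 => if i.val + j.val + 1 = 2 then (1 : L) else 0)).Local v ×
        (cmDatum L 1 (Matrix.of fun i j : Fin 1 => if i.val + j.val + 1 = 1 then (1 : L) else 0)).Local v,
      ((endoEmbLocal L v a₀).val : GL (Fin 3) (LocalRing L v)) = y⁻¹ * γ₀.val * y ∧ IsLocalGRegular L v a₀ ∧ IsLocalNormPair L H' v a₀ γ₀ := by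
  have hcommA := commute_of_commute_of_isRegularElt_local L v (endoEmbLocal L v a) ha
  have hιa : ((endoEmbLocal L v a).val : GL (Fin 3) (LocalRing L v)) = y⁻¹ * t'.val * y := by
    rw [← hy]; simp only [mul_assoc, inv_mul_cancel, mul_one, inv_mul_cancel_left]
  have hy' : y⁻¹ * (t'.val : GL (Fin 3) (LocalRing L v)) * y⁻¹⁻¹ = (endoEmbLocal L v a).val := by rw [inv_inv, hιa]
  have hzγ : (γ₀.val : GL (Fin 3) (LocalRing L v)) * t'.val = t'.val * γ₀.val :=
    (congrArg (fun u : (cmDatum L 3 H').Local v => (u.val : GL (Fin 3) (LocalRing L v))) hc).symm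
  -- `y⁻¹ γ₀ y` is `Φ₃`-unitary (subgroup memberships are passed by definitional unfolding, never by `mem_…_iff` rewriting: the latter makes the
  -- elaborator compare the matrix equations term by term)
  have hg : y⁻¹ * (γ₀.val : GL (Fin 3) (LocalRing L v)) * y ∈
      unitaryGroup (UnitaryGroup.conjLocal L (IsCMField.complexConj L) v)
        ((adelicForm L 3 (Matrix.of fun i j : Fin 3 => if i.val + j.val + 1 = 3 then (1 : L) else 0)).map (adeleToLocal L v)) := by
    have h := conj_mem_unitaryGroup_of_conj_eq (UnitaryGroup.conjLocal L (IsCMField.complexConj L) v)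
      (isUnit_adelicForm_map_adeleToLocal L v hH') (isUnit_adelicForm_map_adeleToLocal L v (isUnit_antidiagOne_det L 3).ne_zero)
      t'.2 (endoEmbLocal L v a).2 hcommA y⁻¹ hy' γ₀.2 hzγ
    rwa [inv_inv] at h
  -- `y⁻¹ γ₀ y` commutes with `ι a`, hence is block-diagonal
  have hgc : y⁻¹ * (γ₀.val : GL (Fin 3) (LocalRing L v)) * y * (endoEmbLocal L v a).val = (endoEmbLocal L v a).val * (y⁻¹ * γ₀.val * y) := by
    rw [hιa]
    calc y⁻¹ * (γ₀.val : GL (Fin 3) (LocalRing L v)) * y * (y⁻¹ * t'.val * y) = y⁻¹ * (γ₀.val * t'.val) * y := by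
          simp only [mul_assoc, mul_inv_cancel_left]
      _ = y⁻¹ * (t'.val * γ₀.val) * y := by rw [hzγ]
      _ = y⁻¹ * t'.val * y * (y⁻¹ * γ₀.val * y) := by simp only [mul_assoc, mul_inv_cancel_left]
  obtain ⟨⟨A, D⟩, hAD⟩ := mem_range_endoGL_of_commute L v ha hgc
  -- its blocks are unitary
  have hu : endoGL (A, D) ∈ unitaryGroupOfForm (UnitaryGroup.conjLocal L (IsCMField.complexConj L) v)
      (endoForm ((adelicForm L 2 (Matrix.of fun i j : Fin 2 => if i.val + j.val + 1 = 2 then (1 : L) else 0)).map (adeleToLocal L v))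
        ((adelicForm L 1 (Matrix.of fun i j : Fin 1 => if i.val + j.val + 1 = 1 then (1 : L) else 0)).map (adeleToLocal L v))) := by
    rw [endoForm_localForm L v, hAD]
    exact hg
  obtain ⟨hA, hD⟩ := (endoGL_mem_iff _ _ _ A D).1 hu
  refine ⟨(⟨A, hA⟩, ⟨D, hD⟩), hAD, ?_, ?_⟩
  · -- `G`-regular: `ι a₀ = y⁻¹ γ₀ y` is conjugate to the regular `γ₀`
    refine isRegularElt_of_isConj (isConj_iff.2 ⟨y⁻¹, ?_⟩) hγ₀
    change y⁻¹ * (γ₀.val : GL (Fin 3) (LocalRing L v)) * y⁻¹⁻¹ = endoGL (A, D)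
    rw [hAD, inv_inv]
  · -- matches `γ₀`
    rw [isLocalNormPair_iff]
    refine isConj_iff.2 ⟨y, ?_⟩
    change y * endoGL (A, D) * y⁻¹ = (γ₀.val : GL (Fin 3) (LocalRing L v))
    rw [hAD]
    simp only [mul_assoc, mul_inv_cancel_left, mul_inv_cancel, mul_one]

end Preimage

/-! ## §3 (W2′) The fibre representatives at `γ₀` serve along the whole torus -/

section Uniform

/-- In a group of units, `P a P⁻¹ = a` gives `P⁻¹ a = a P⁻¹` (stated for `Mˣ` so that the instance paths match the `GL`-terms syntactically).
[folklore] -/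
private theorem inv_mul_eq_mul_inv_of_conj_eq {M : Type*} [Monoid M] {P g : Mˣ} (h : P * g * P⁻¹ = g) : P⁻¹ * g = g * P⁻¹ := by
  have h1 : P * g = g * P := by
    calc P * g = P * g * P⁻¹ * P := by group
      _ = g * P := by rw [h]
  calc P⁻¹ * g = P⁻¹ * (g * P) * P⁻¹ := by group
    _ = P⁻¹ * (P * g) * P⁻¹ := by rw [h1]
    _ = g * P⁻¹ := by group

/-- In a group of units, `(y⁻¹ x) B (y⁻¹ x)⁻¹ = y⁻¹ (x B x⁻¹) y`. [folklore] -/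
private theorem inv_mul_conj_eq {M : Type*} [Monoid M] (y x B : Mˣ) : y⁻¹ * x * B * (y⁻¹ * x)⁻¹ = y⁻¹ * (x * B * x⁻¹) * y := by
  rw [_root_.mul_inv_rev, inv_inv]
  simp only [mul_assoc]

/-- **The conjugator `y⁻¹ x` is block-diagonal.**  If `a₀ ∼_st t` in `H_v` (`a₀` `G`-regular), `ι_v(a₀) = y⁻¹ g y` and `x ι_v(t) x⁻¹ = g` for some
`g, x, y ∈ GL₃(E_v)`, then `y⁻¹ x ∈ ι(GL₂ × GL₁)`: with the block-diagonal `B` conjugating `ι(a₀)` to `ι(t)`, `P := y⁻¹ x B` fixes `ι(a₀)` under conjugation, so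
`P⁻¹` lies in the block-diagonal commutant of `ι(a₀)` (★ `mem_range_endoGL_of_commute`). [cite: Rogawski1990, §4.3 pp. 42–44; §4.8 Case (a) p. 53] -/
theorem exists_endoGL_eq_inv_mul
    {a₀ t : (cmDatum L 2 (Matrix.of fun i j : Fin 2 => if i.val + j.val + 1 = 2 then (1 : L) else 0)).Local v ×
      (cmDatum L 1 (Matrix.of fun i j : Fin 1 => if i.val + j.val + 1 = 1 then (1 : L) else 0)).Local v}
    (ha₀reg : IsLocalGRegular L v a₀) (hst : IsLocalStablyConjH L v a₀ t) {g x y : GL (Fin 3) (LocalRing L v)}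
    (ha₀ : ((endoEmbLocal L v a₀).val : GL (Fin 3) (LocalRing L v)) = y⁻¹ * g * y)
    (hx : x * ((endoEmbLocal L v t).val : GL (Fin 3) (LocalRing L v)) * x⁻¹ = g) :
    ∃ p : GL (Fin 2) (LocalRing L v) × GL (Fin 1) (LocalRing L v), endoGL p = y⁻¹ * x := by
  -- a block-diagonal conjugator `B := ι(c₁, c₂)` from `a₀ ∼_st t`
  obtain ⟨c₁, hc₁⟩ := isConj_iff.1 hst.1
  obtain ⟨c₂, hc₂⟩ := isConj_iff.1 hst.2
  have e : ∀ c : (cmDatum L 2 (Matrix.of fun i j : Fin 2 => if i.val + j.val + 1 = 2 then (1 : L) else 0)).Local v ×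
      (cmDatum L 1 (Matrix.of fun i j : Fin 1 => if i.val + j.val + 1 = 1 then (1 : L) else 0)).Local v,
      ((endoEmbLocal L v c).val : GL (Fin 3) (LocalRing L v)) =
        endoGL ((c.1.val : GL (Fin 2) (LocalRing L v)), (c.2.val : GL (Fin 1) (LocalRing L v))) := fun _ => rfl
  have hblk : endoGL (c₁, c₂) * ((endoEmbLocal L v a₀).val : GL (Fin 3) (LocalRing L v)) * (endoGL (c₁, c₂))⁻¹ = (endoEmbLocal L v t).val := by
    rw [e a₀, e t, ← map_inv, ← map_mul, ← map_mul, Prod.inv_mk, Prod.mk_mul_mk, Prod.mk_mul_mk, hc₁, hc₂]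
  -- `P := y⁻¹ x B` conjugates `ι a₀` to itself, so `P⁻¹` lies in the (block-diagonal) commutant of `ι a₀`
  have hP : y⁻¹ * x * endoGL (c₁, c₂) * ((endoEmbLocal L v a₀).val : GL (Fin 3) (LocalRing L v)) * (y⁻¹ * x * endoGL (c₁, c₂))⁻¹ =
      (endoEmbLocal L v a₀).val := by
    conv_rhs => rw [ha₀, ← hx, ← hblk]
    simp only [_root_.mul_inv_rev, inv_inv, mul_assoc]
  have hkcomm := inv_mul_eq_mul_inv_of_conj_eq hP
  obtain ⟨q, hq⟩ := mem_range_endoGL_of_commute L v ha₀reg hkcomm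
  refine ⟨q⁻¹ * (c₁, c₂)⁻¹, ?_⟩
  rw [map_mul, map_inv, map_inv, hq, inv_inv]
  simp only [mul_inv_cancel_right]

/-- **(W2′) UNIFORM FIBRE ALONG THE TRANSPORTED TORUS.**  `γ₀ ∈ G′_v` regular, `S ⊂ H_v` a set of fibre representatives at `γ₀` (every `G`-regular `a₀ ↔ γ₀` is stably
conjugate to some `t ∈ S` — ★ `exists_finset_normFibre`), `t′ ∈ Z_{G′_v}(γ₀)`, and `a ∈ H_v` `G`-regular with `a ↔ t′`.  Then there is `t ∈ S` such that for EVERY conjugator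
`x` with `x ι_v(t) x⁻¹ = γ₀`, the transport `b ∈ H_v` of `t′` along `x` (`x ι_v(b) x⁻¹ = t′`, i.e. `b = θ_t⁻¹(t′)` for the torus isomorphism `Z_H(t) ≃ Z_{G′}(γ₀)`, `z ↦ x ι(z) x⁻¹`)
satisfies `a ∼_st b`.  Every finite `v`. [cite: Rogawski1990, §4.3 pp. 42–44; §5.4 p. 78] [cite: LanglandsShelstad1987, §1.3] -/
theorem exists_mem_forall_isLocalStablyConjH_of_conj_eq (hH' : H'.det ≠ 0) (γ₀ : (cmDatum L 3 H').Local v)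
    (hγ₀ : IsRegularElt (γ₀.val : GL (Fin 3) (LocalRing L v)))
    (S : Finset ((cmDatum L 2 (Matrix.of fun i j : Fin 2 => if i.val + j.val + 1 = 2 then (1 : L) else 0)).Local v ×
      (cmDatum L 1 (Matrix.of fun i j : Fin 1 => if i.val + j.val + 1 = 1 then (1 : L) else 0)).Local v))
    (hS : ∀ a₀, IsLocalGRegular L v a₀ → IsLocalNormPair L H' v a₀ γ₀ → ∃ t ∈ S, IsLocalStablyConjH L v a₀ t)
    {t' : (cmDatum L 3 H').Local v} (ht' : t' ∈ Subgroup.centralizer ({γ₀} : Set ((cmDatum L 3 H').Local v)))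
    {a : (cmDatum L 2 (Matrix.of fun i j : Fin 2 => if i.val + j.val + 1 = 2 then (1 : L) else 0)).Local v ×
      (cmDatum L 1 (Matrix.of fun i j : Fin 1 => if i.val + j.val + 1 = 1 then (1 : L) else 0)).Local v}
    (ha : IsLocalGRegular L v a) (h : IsLocalNormPair L H' v a t') :
    ∃ t ∈ S, ∀ x : GL (Fin 3) (LocalRing L v), x * ((endoEmbLocal L v t).val : GL (Fin 3) (LocalRing L v)) * x⁻¹ = γ₀.val →
      ∀ b : (cmDatum L 2 (Matrix.of fun i j : Fin 2 => if i.val + j.val + 1 = 2 then (1 : L) else 0)).Local v ×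
          (cmDatum L 1 (Matrix.of fun i j : Fin 1 => if i.val + j.val + 1 = 1 then (1 : L) else 0)).Local v,
        x * ((endoEmbLocal L v b).val : GL (Fin 3) (LocalRing L v)) * x⁻¹ = t'.val → IsLocalStablyConjH L v a b := by
  -- a conjugator `y` for `ι a ↔ t′`
  rw [isLocalNormPair_iff] at h
  obtain ⟨y, hy⟩ := isConj_iff.1 h
  have hc : t' * γ₀ = γ₀ * t' := Subgroup.mem_centralizer_singleton_iff.1 ht'
  obtain ⟨a₀, ha₀, ha₀reg, ha₀m⟩ := exists_preimage_of_conj_eq_of_commute L H' v hH' ha hy γ₀ hγ₀ hc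
  obtain ⟨t, htS, hst⟩ := hS a₀ ha₀reg ha₀m
  refine ⟨t, htS, fun x hx b hb => ?_⟩
  obtain ⟨p, hyx⟩ := exists_endoGL_eq_inv_mul L v ha₀reg hst ha₀ hx
  have hιa : ((endoEmbLocal L v a).val : GL (Fin 3) (LocalRing L v)) = y⁻¹ * t'.val * y := by
    rw [← hy]; simp only [mul_assoc, inv_mul_cancel, mul_one, inv_mul_cancel_left]
  -- (rewrite in the hypothesis, not in the goal: keyed rewriting must never compare `endoGL _` with `ι_v _`, whose carriers unfold expensively)
  have key : y⁻¹ * x * ((endoEmbLocal L v b).val : GL (Fin 3) (LocalRing L v)) * (y⁻¹ * x)⁻¹ = (endoEmbLocal L v a).val := by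
    rw [hιa, ← hb]
    exact inv_mul_conj_eq y x _
  rw [← hyx] at key
  exact isLocalStablyConjH_of_endoGL_conj_eq L v key

end Uniform

end Literature.NumberTheory.Rogawski1990

end
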